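import Summits.QuantumFields.YangMills.Theorems.BalabanLadderUVSeamRecCeilingsProductMoments
import HarnessLib

/-!
# Crux `UVSeamRec` (stmt-QuantumFields-20043), v5(α) stub `stub_responseMomentsOdd6`: the product-moment currency (PM) as a
# tooled binder — (RM) ⇒ (PM), (PM) pins its reference values, recentring, and the press-button to `stub_ceilings`

Helper file (`--supports stmt-QuantumFields-20043`) of the stub-helper seat `ym-20043-seam-s2` (lane S-A, gen 2); sequel of
`…CeilingsProductMoments.lean` (§2 there: `momentBounds6_of_productMoments : (PM) → MomentBounds6 G r a`) and the (PM) twin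
of `…ResponseMomentsPinning.lean` / `…ResponseMomentsRecentring.lean`.

* §1 **`productMoments_of_responseMoments`** — (RM) ⇒ (PM) on the same guards (pointwise
  `∏(1 + yᵢ) ≤ exp(Σ yᵢ)`): the v5(α) chain (RM) ⇒ `MomentBounds6` factors through the WEAKER (PM).
* §2 `torusE_abs_sub_le_of_prodMoment`, **`abs_torusE_plane_sub_le_of_productMoments`** — (PM) pins its reference values
  exactly as (RM) does: `|⟨plane q x⟩_{2L+1,β} − p q β| ≤ C₁(e^B − 1)/R⁴` on the guards (one-member family + torus DLR); so
  the finite-size content of `…ResponseMomentsPinning` §2 is a necessary condition of (PM) too.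
* §3 `prod_response_recentre_le`, `torusE_prod_response_recentre`, **`productMomentsCentred_of_productMoments`**,
  **`productMoments_of_centred_of_pinned`** — recentring for products (`1 + λ|k − c'| ≤ (1 + λδ)(1 + λ|k − c|)`,
  `(1 + λδ)^{#T} ≤ e^{λδ·#T}`): (PM)[`p`, `B`] ⇒ centred (PM) [`B + e^B − 1`]; centred (PM) [`B`] + pinning `D/R⁴` ⇒
  (PM)[`p`, `B + D/C₁`] — the same constants as the (RM) conversions.
* §4 `momentBounds6_of_productMoments_eventually`, **`stubCeilings_of_productMoments`** — (PM) at a unit `a ≤ c·uRec`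
  eventually ⇒ `MomentBounds6 (SU(2)) rF Transport.uRec`, the conclusion of the registered `stub_ceilings` VERBATIM (the
  (PM) twin of p532738): a v6 skeleton with ONE non-fed stub `stub_productMomentsOdd6 : UV → (PM at some a ≤ c·uRec)` closes
  `stub_ceilings` by `exact stubCeilings_of_productMoments (stub_productMomentsOdd6 hUV)`.

HONEST FRAMING: composition/necessary conditions only; (PM) and the flow window are OPEN inputs; nothing of E0′ is claimed;
not a gap, not Clay.

References: as `…CeilingsProductMoments` (Georgii (2011) Thm. 4.17 for the DLR step); `1 + y ≤ eʸ`.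
-/

set_option autoImplicit false

noncomputable section

open MeasureTheory Filter Topology Finset
open Literature.Probability.LatticeModels
open Literature.MathematicalPhysics.QuantumFieldTheory (GaugeConfig wilsonMeasure isProbabilityMeasure_wilsonMeasure
  measurable_torusLift LatticeRep)
open Literature.MathematicalPhysics.QuantumLattice

namespace Summit.QuantumFields.YangMills.Cruxes.UVSeamRec.ProductMoments

/-! ## §1 The registered currency implies the product currency -/

section Dominance

open Summit.QuantumFields.YangMills.Cruxes.OSLegsFromFemtoAndGap.DlrCollarTransfer
open Summit.QuantumFields.YangMills.Cruxes.UVSeamRec.TemperedResponse (continuous_kerE_plane)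

variable {G : Type} [Group G] [TopologicalSpace G] [IsTopologicalGroup G] [CompactSpace G]
  [MeasurableSpace G] [BorelSpace G] (r : LatticeRep G) (a : ℝ → ℝ)

/-- **(RM) ⇒ (PM).**  The joint exponential response moments of the registered binder dominate the joint product
moments: on the same guards and for every index set `T`,
`⟨∏_{i∈T}(1 + (R⁴/C₁)|kerE_i − p_i|)⟩_{2L+1,β} ≤ ⟨exp(Σ_{i∈T} (R⁴/C₁)|kerE_i − p_i|)⟩_{2L+1,β} ≤ exp(B·#T)`; so the v5(α)
chain (RM) ⇒ `MomentBounds6` factors through the weaker (PM). [folklore] -/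
theorem productMoments_of_responseMoments {C₁ B β₁ ℓ₁ : ℝ} {p : Fin 4 × Fin 4 → ℝ → ℝ} (hC₁ : 0 < C₁)
    (hRM : ∀ β : ℝ, β₁ ≤ β → ∀ (L n : ℕ) (q : Fin n → Fin 4 × Fin 4) (x : Fin n → (Fin 4 → ℤ)) (R : ℕ),
      (∀ i, (q i).1 < (q i).2) → 1 ≤ R → (R : ℝ) * a β ≤ ℓ₁ → 4 * R + 8 ≤ L →
      (∀ i j : Fin n, i ≠ j → ∃ k : Fin 4,
        (2 * (R : ℤ) + 4) ≤ |((((x i k - x j k : ℤ) : ZMod (2 * L + 1))).valMinAbs : ℤ)|) →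
      ∀ T : Finset (Fin n),
        torusE G r β L (fun U => Real.exp (∑ i ∈ T, (R : ℝ) ^ 4 / C₁ *
          |kerE G r β (fun k => x i k - (R + 1)) (2 * R + 3) U (plane G r (q i) (x i)) - p (q i) β|)) ≤
          Real.exp (B * T.card)) :
    ∀ β : ℝ, β₁ ≤ β → ∀ (L n : ℕ) (q : Fin n → Fin 4 × Fin 4) (x : Fin n → (Fin 4 → ℤ)) (R : ℕ),
      (∀ i, (q i).1 < (q i).2) → 1 ≤ R → (R : ℝ) * a β ≤ ℓ₁ → 4 * R + 8 ≤ L →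
      (∀ i j : Fin n, i ≠ j → ∃ k : Fin 4,
        (2 * (R : ℤ) + 4) ≤ |((((x i k - x j k : ℤ) : ZMod (2 * L + 1))).valMinAbs : ℤ)|) →
      ∀ T : Finset (Fin n),
        torusE G r β L (fun U => ∏ i ∈ T, (1 + (R : ℝ) ^ 4 / C₁ *
          |kerE G r β (fun k => x i k - (R + 1)) (2 * R + 3) U (plane G r (q i) (x i)) - p (q i) β|)) ≤
          Real.exp (B * T.card) := by
  intro β hβ L n q x R hq hR hRa hRL hsep T
  have hc : ∀ i : Fin n, Continuous fun U : LGConfig 4 G => (R : ℝ) ^ 4 / C₁ *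
      |kerE G r β (fun k => x i k - (R + 1)) (2 * R + 3) U (plane G r (q i) (x i)) - p (q i) β| := fun i =>
    continuous_const.mul ((continuous_kerE_plane r β _ _ (q i) (x i)).sub continuous_const).abs
  refine le_trans ?_ (hRM β hβ L n q x R hq hR hRa hRL hsep T)
  refine ResponsePinning.torusE_mono r β L (continuous_finsetProd T fun i _ => continuous_const.add (hc i))
    (Real.continuous_exp.comp (continuous_finsetSum T fun i _ => hc i)) fun U => ?_
  -- pointwise `∏(1 + yᵢ) ≤ ∏ exp yᵢ = exp Σ yᵢ` (the tree's `CubicSieve.prod_one_add_le_exp_sum`, inlined to keep imports local)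
  rw [Real.exp_sum]
  exact Finset.prod_le_prod (fun i _ => by positivity) fun i _ => by
    linarith [Real.add_one_le_exp ((R : ℝ) ^ 4 / C₁ *
      |kerE G r β (fun k => x i k - (R + 1)) (2 * R + 3) U (plane G r (q i) (x i)) - p (q i) β|)]

end Dominance

/-! ## §2 (PM) pins its reference values -/

section Pinning

open Summit.QuantumFields.YangMills.Cruxes.OSLegsFromFemtoAndGap.DlrCollarTransfer
open Summit.QuantumFields.YangMills.Cruxes.UVSeamRec.TemperedResponse (continuous_kerE_plane)
open Summit.QuantumFields.YangMills.Cruxes.UVSeamRec.ResponsePinning (torusE_mono torusE_const torusE_add'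
  torusE_const_mul' torusE_plane_eq_torusE_kerE)

variable {G : Type} [Group G] [TopologicalSpace G] [IsTopologicalGroup G] [CompactSpace G]
  [MeasurableSpace G] [BorelSpace G] (r : LatticeRep G) (a : ℝ → ℝ)

/-- The one-site PRODUCT-moment bound: `⟨1 + λ|k − p|⟩ ≤ e^B` with `λ > 0` gives `⟨|k − p|⟩ ≤ (e^B − 1)/λ`. [folklore] -/
theorem torusE_abs_sub_le_of_prodMoment (β : ℝ) (L : ℕ) {k : LGConfig 4 G → ℝ} (hk : Continuous k) {lam : ℝ}
    (hlam : 0 < lam) {p B : ℝ} (h : torusE G r β L (fun U => 1 + lam * |k U - p|) ≤ Real.exp B) :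
    torusE G r β L (fun U => |k U - p|) ≤ (Real.exp B - 1) / lam := by
  have hc1 : Continuous fun U => |k U - p| := (hk.sub continuous_const).abs
  have hc2 : Continuous fun U => lam * |k U - p| := continuous_const.mul hc1
  rw [show (fun U => 1 + lam * |k U - p|) = (fun U => (fun _ => (1 : ℝ)) U + lam * |k U - p|) from rfl,
    torusE_add' r β L continuous_const hc2, torusE_const, torusE_const_mul'] at h
  rw [le_div_iff₀ hlam]
  linarith

/-- **(PM) pins its reference values** — the product-moment twin of `ResponsePinning.abs_torusE_plane_sub_le_of_responseMoments`:
under (PM) at unit `a` [`p`, `C₁ > 0`, `B`, `β₁`, `ℓ₁`], for `β ≥ β₁`, `1 ≤ R`, `R·a β ≤ ℓ₁`, `4R+8 ≤ L`, `q.1 < q.2`: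
`|⟨plane q x⟩_{2L+1,β} − p q β| ≤ C₁(e^B − 1)/R⁴` (one-member family; one-site product moment; torus DLR).
[folklore: Georgii (2011) Thm. 4.17] -/
theorem abs_torusE_plane_sub_le_of_productMoments {C₁ B β₁ ℓ₁ : ℝ} {p : Fin 4 × Fin 4 → ℝ → ℝ} (hC₁ : 0 < C₁)
    (hPM : ∀ β : ℝ, β₁ ≤ β → ∀ (L n : ℕ) (q : Fin n → Fin 4 × Fin 4) (x : Fin n → (Fin 4 → ℤ)) (R : ℕ),
      (∀ i, (q i).1 < (q i).2) → 1 ≤ R → (R : ℝ) * a β ≤ ℓ₁ → 4 * R + 8 ≤ L →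
      (∀ i j : Fin n, i ≠ j → ∃ k : Fin 4,
        (2 * (R : ℤ) + 4) ≤ |((((x i k - x j k : ℤ) : ZMod (2 * L + 1))).valMinAbs : ℤ)|) →
      ∀ T : Finset (Fin n),
        torusE G r β L (fun U => ∏ i ∈ T, (1 + (R : ℝ) ^ 4 / C₁ *
          |kerE G r β (fun k => x i k - (R + 1)) (2 * R + 3) U (plane G r (q i) (x i)) - p (q i) β|)) ≤
          Real.exp (B * T.card))
    {β : ℝ} (hβ : β₁ ≤ β) {L R : ℕ} (q : Fin 4 × Fin 4) (x : Fin 4 → ℤ) (hq : q.1 < q.2) (hR : 1 ≤ R)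
    (hRa : (R : ℝ) * a β ≤ ℓ₁) (hRL : 4 * R + 8 ≤ L) :
    |torusE G r β L (plane G r q x) - p q β| ≤ C₁ * (Real.exp B - 1) / (R : ℝ) ^ 4 := by
  have h1 := hPM β hβ L 1 (fun _ => q) (fun _ => x) R (fun _ => hq) hR hRa hRL
    (fun i j hij => absurd (Subsingleton.elim i j) hij) Finset.univ
  simp only [Finset.univ_unique, Finset.prod_singleton, Finset.card_singleton, Nat.cast_one, mul_one] at h1
  set k : LGConfig 4 G → ℝ := fun U => kerE G r β (fun k => x k - (R + 1)) (2 * R + 3) U (plane G r q x) with hk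
  have hkc : Continuous k := continuous_kerE_plane r β _ _ q x
  have hR0 : (0 : ℝ) < R := by exact_mod_cast (show 0 < R by omega)
  have hlam : 0 < (R : ℝ) ^ 4 / C₁ := by positivity
  have h2 : torusE G r β L (fun U => |k U - p q β|) ≤ (Real.exp B - 1) / ((R : ℝ) ^ 4 / C₁) :=
    torusE_abs_sub_le_of_prodMoment r β L hkc hlam (p := p q β) (B := B) h1
  have h3 : (Real.exp B - 1) / ((R : ℝ) ^ 4 / C₁) = C₁ * (Real.exp B - 1) / (R : ℝ) ^ 4 := by
    field_simp
  rw [h3] at h2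
  rw [torusE_plane_eq_torusE_kerE r β q x R L (by omega)]
  have h4 : torusE G r β L k - p q β = torusE G r β L (fun U => k U - p q β) := by
    rw [show (fun U => k U - p q β) = (fun U => k U + -p q β) from funext fun _ => sub_eq_add_neg _ _,
      torusE_add' r β L hkc continuous_const, torusE_const]
    ring
  change |torusE G r β L k - p q β| ≤ _
  rw [h4]
  unfold torusE at h2 ⊢
  exact (abs_integral_le_integral_abs).trans h2

end Pinning

/-! ## §3 Recentring for product moments -/

section Recentring

open Summit.QuantumFields.YangMills.Cruxes.OSLegsFromFemtoAndGap.DlrCollarTransfer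
open Summit.QuantumFields.YangMills.Cruxes.UVSeamRec.TemperedResponse (continuous_kerE_plane)
open Summit.QuantumFields.YangMills.Cruxes.UVSeamRec.ResponsePinning (torusE_mono torusE_const_mul')

variable {G : Type} [Group G] [TopologicalSpace G] [IsTopologicalGroup G] [CompactSpace G]
  [MeasurableSpace G] [BorelSpace G] (r : LatticeRep G) (a : ℝ → ℝ)

/-- Pointwise recentring of a response PRODUCT: if `|c i − c' i| ≤ δ` on `T`, `λ ≥ 0`, `δ ≥ 0`, then
`∏_{i∈T}(1 + λ|k i − c' i|) ≤ exp(λδ·#T) · ∏_{i∈T}(1 + λ|k i − c i|)`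
(`1 + λ|k − c'| ≤ (1 + λδ)(1 + λ|k − c|)` and `(1 + λδ)^{#T} ≤ e^{λδ·#T}`). [folklore] -/
theorem prod_response_recentre_le {n : ℕ} (T : Finset (Fin n)) (k c c' : Fin n → ℝ) {lam δ : ℝ} (hlam : 0 ≤ lam)
    (hδ : 0 ≤ δ) (hclose : ∀ i ∈ T, |c i - c' i| ≤ δ) :
    ∏ i ∈ T, (1 + lam * |k i - c' i|) ≤ Real.exp (lam * δ * T.card) * ∏ i ∈ T, (1 + lam * |k i - c i|) := by
  have hpt : ∀ i ∈ T, 1 + lam * |k i - c' i| ≤ (1 + lam * δ) * (1 + lam * |k i - c i|) := fun i hi => by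
    have h1 : |k i - c' i| ≤ |k i - c i| + δ := by
      calc |k i - c' i| ≤ |k i - c i| + |c i - c' i| := abs_sub_le _ _ _
        _ ≤ |k i - c i| + δ := by linarith [hclose i hi]
    nlinarith [mul_nonneg hlam (abs_nonneg (k i - c i)), mul_nonneg hlam hδ,
      mul_nonneg (mul_nonneg hlam hδ) (mul_nonneg hlam (abs_nonneg (k i - c i)))]
  calc ∏ i ∈ T, (1 + lam * |k i - c' i|)
      ≤ ∏ i ∈ T, ((1 + lam * δ) * (1 + lam * |k i - c i|)) :=
        Finset.prod_le_prod (fun i _ => by positivity) hpt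
    _ = (1 + lam * δ) ^ T.card * ∏ i ∈ T, (1 + lam * |k i - c i|) := by
        rw [Finset.prod_mul_distrib, Finset.prod_const]
    _ ≤ Real.exp (lam * δ * T.card) * ∏ i ∈ T, (1 + lam * |k i - c i|) := by
        refine mul_le_mul_of_nonneg_right ?_ (Finset.prod_nonneg fun i _ => by positivity)
        calc (1 + lam * δ) ^ T.card ≤ (Real.exp (lam * δ)) ^ T.card :=
              pow_le_pow_left₀ (by positivity) (by linarith [Real.add_one_le_exp (lam * δ)]) _
          _ = Real.exp (lam * δ * T.card) := by rw [← Real.exp_nat_mul]; ring_nf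

/-- Continuity of a response product in the exterior. [folklore] -/
theorem continuous_prod_response (β : ℝ) {n : ℕ} (T : Finset (Fin n)) (q : Fin n → Fin 4 × Fin 4)
    (x : Fin n → (Fin 4 → ℤ)) (R : ℕ) (lam : ℝ) (c : Fin n → ℝ) :
    Continuous fun U : LGConfig 4 G => ∏ i ∈ T, (1 + lam *
      |kerE G r β (fun k => x i k - (R + 1)) (2 * R + 3) U (plane G r (q i) (x i)) - c i|) :=
  continuous_finsetProd T fun i _ => continuous_const.add
    (continuous_const.mul ((continuous_kerE_plane r β _ _ (q i) (x i)).sub continuous_const).abs)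

/-- **Recentring a response product at one coupling, one torus, one family (the core estimate).**  For `C₁ > 0` and
centres `c, c'` with `|c i − c' i| ≤ δ` (`δ ≥ 0`) on `T`:
`⟨∏_{i∈T}(1 + (R⁴/C₁)|kerE_i − c' i|)⟩_{2L+1,β} ≤ exp((R⁴/C₁)δ·#T) · ⟨∏_{i∈T}(1 + (R⁴/C₁)|kerE_i − c i|)⟩_{2L+1,β}`.
[folklore] -/
theorem torusE_prod_response_recentre (β : ℝ) (L : ℕ) {n : ℕ} (T : Finset (Fin n)) (q : Fin n → Fin 4 × Fin 4)
    (x : Fin n → (Fin 4 → ℤ)) (R : ℕ) {C₁ : ℝ} (hC₁ : 0 < C₁) (c c' : Fin n → ℝ) {δ : ℝ} (hδ : 0 ≤ δ)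
    (hclose : ∀ i ∈ T, |c i - c' i| ≤ δ) :
    torusE G r β L (fun U => ∏ i ∈ T, (1 + (R : ℝ) ^ 4 / C₁ *
        |kerE G r β (fun k => x i k - (R + 1)) (2 * R + 3) U (plane G r (q i) (x i)) - c' i|)) ≤
      Real.exp ((R : ℝ) ^ 4 / C₁ * δ * T.card) *
        torusE G r β L (fun U => ∏ i ∈ T, (1 + (R : ℝ) ^ 4 / C₁ *
          |kerE G r β (fun k => x i k - (R + 1)) (2 * R + 3) U (plane G r (q i) (x i)) - c i|)) := by
  have hlam : 0 ≤ (R : ℝ) ^ 4 / C₁ := by positivity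
  have hpt := fun U : LGConfig 4 G => prod_response_recentre_le T
    (fun i => kerE G r β (fun k => x i k - (R + 1)) (2 * R + 3) U (plane G r (q i) (x i))) c c' hlam hδ hclose
  calc _ ≤ torusE G r β L (fun U => Real.exp ((R : ℝ) ^ 4 / C₁ * δ * T.card) *
          ∏ i ∈ T, (1 + (R : ℝ) ^ 4 / C₁ *
            |kerE G r β (fun k => x i k - (R + 1)) (2 * R + 3) U (plane G r (q i) (x i)) - c i|)) :=
        torusE_mono r β L (continuous_prod_response r β T q x R _ _)
          (continuous_const.mul (continuous_prod_response r β T q x R _ _)) hpt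
    _ = _ := torusE_const_mul' r β L _ _

/-- **(PM) conversion 1: reference values ⇒ torus means.**  Under (PM) at unit `a` [`p`, `C₁ > 0`, `B`, `β₁`, `ℓ₁`], on
the same guards and for every `T`, the response products CENTRED AT THE TORUS MEANS obey
`⟨∏_{i∈T}(1 + (R⁴/C₁)|kerE_i − ⟨plane_i⟩_{2L+1,β}|)⟩_{2L+1,β} ≤ exp((B + e^B − 1)·#T)`. [folklore] -/
theorem productMomentsCentred_of_productMoments {C₁ B β₁ ℓ₁ : ℝ} {p : Fin 4 × Fin 4 → ℝ → ℝ} (hC₁ : 0 < C₁)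
    (hPM : ∀ β : ℝ, β₁ ≤ β → ∀ (L n : ℕ) (q : Fin n → Fin 4 × Fin 4) (x : Fin n → (Fin 4 → ℤ)) (R : ℕ),
      (∀ i, (q i).1 < (q i).2) → 1 ≤ R → (R : ℝ) * a β ≤ ℓ₁ → 4 * R + 8 ≤ L →
      (∀ i j : Fin n, i ≠ j → ∃ k : Fin 4,
        (2 * (R : ℤ) + 4) ≤ |((((x i k - x j k : ℤ) : ZMod (2 * L + 1))).valMinAbs : ℤ)|) →
      ∀ T : Finset (Fin n),
        torusE G r β L (fun U => ∏ i ∈ T, (1 + (R : ℝ) ^ 4 / C₁ *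
          |kerE G r β (fun k => x i k - (R + 1)) (2 * R + 3) U (plane G r (q i) (x i)) - p (q i) β|)) ≤
          Real.exp (B * T.card)) :
    ∀ β : ℝ, β₁ ≤ β → ∀ (L n : ℕ) (q : Fin n → Fin 4 × Fin 4) (x : Fin n → (Fin 4 → ℤ)) (R : ℕ),
      (∀ i, (q i).1 < (q i).2) → 1 ≤ R → (R : ℝ) * a β ≤ ℓ₁ → 4 * R + 8 ≤ L →
      (∀ i j : Fin n, i ≠ j → ∃ k : Fin 4,
        (2 * (R : ℤ) + 4) ≤ |((((x i k - x j k : ℤ) : ZMod (2 * L + 1))).valMinAbs : ℤ)|) →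
      ∀ T : Finset (Fin n),
        torusE G r β L (fun U => ∏ i ∈ T, (1 + (R : ℝ) ^ 4 / C₁ *
          |kerE G r β (fun k => x i k - (R + 1)) (2 * R + 3) U (plane G r (q i) (x i)) -
            torusE G r β L (plane G r (q i) (x i))|)) ≤
          Real.exp ((B + (Real.exp B - 1)) * T.card) := by
  intro β hβ L n q x R hq hR hRa hRL hsep T
  have hR0 : (0 : ℝ) < R := by exact_mod_cast (show 0 < R by omega)
  have hclose : ∀ i ∈ T, |p (q i) β - torusE G r β L (plane G r (q i) (x i))| ≤
      C₁ * (Real.exp B - 1) / (R : ℝ) ^ 4 := fun i _ => by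
    rw [abs_sub_comm]
    exact abs_torusE_plane_sub_le_of_productMoments r a hC₁ hPM hβ (q i) (x i) (hq i) hR hRa hRL
  rcases T.eq_empty_or_nonempty with hT | ⟨i₀, hi₀⟩
  · subst hT
    have h0 := hPM β hβ L n q x R hq hR hRa hRL hsep ∅
    simpa using h0
  have hδ0 : 0 ≤ C₁ * (Real.exp B - 1) / (R : ℝ) ^ 4 := (abs_nonneg _).trans (hclose i₀ hi₀)
  have hδ : (R : ℝ) ^ 4 / C₁ * (C₁ * (Real.exp B - 1) / (R : ℝ) ^ 4) * T.card = (Real.exp B - 1) * T.card := by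
    field_simp
  calc _ ≤ Real.exp ((R : ℝ) ^ 4 / C₁ * (C₁ * (Real.exp B - 1) / (R : ℝ) ^ 4) * T.card) *
          torusE G r β L (fun U => ∏ i ∈ T, (1 + (R : ℝ) ^ 4 / C₁ *
            |kerE G r β (fun k => x i k - (R + 1)) (2 * R + 3) U (plane G r (q i) (x i)) - p (q i) β|)) :=
        torusE_prod_response_recentre r β L T q x R hC₁ (fun i => p (q i) β)
          (fun i => torusE G r β L (plane G r (q i) (x i))) hδ0 hclose
    _ ≤ Real.exp ((Real.exp B - 1) * T.card) * Real.exp (B * T.card) := by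
        rw [hδ]
        exact mul_le_mul_of_nonneg_left (hPM β hβ L n q x R hq hR hRa hRL hsep T) (Real.exp_nonneg _)
    _ = Real.exp ((B + (Real.exp B - 1)) * T.card) := by rw [← Real.exp_add]; ring_nf

/-- **(PM) conversion 2: torus means + finite-size pinning ⇒ reference values.**  Centred response products with
`⟨∏_{i∈T}(1 + (R⁴/C₁)|kerE_i − ⟨plane_i⟩|)⟩ ≤ exp(B·#T)` on the guards, plus the pinning `|⟨plane q x⟩_{2L+1,β} − p q β| ≤ D/R⁴`
(same guards, `q.1 < q.2`), give (PM) about `p` with `B ↦ B + D/C₁`. [folklore] -/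
theorem productMoments_of_centred_of_pinned {C₁ B D β₁ ℓ₁ : ℝ} {p : Fin 4 × Fin 4 → ℝ → ℝ} (hC₁ : 0 < C₁)
    (hcen : ∀ β : ℝ, β₁ ≤ β → ∀ (L n : ℕ) (q : Fin n → Fin 4 × Fin 4) (x : Fin n → (Fin 4 → ℤ)) (R : ℕ),
      (∀ i, (q i).1 < (q i).2) → 1 ≤ R → (R : ℝ) * a β ≤ ℓ₁ → 4 * R + 8 ≤ L →
      (∀ i j : Fin n, i ≠ j → ∃ k : Fin 4,
        (2 * (R : ℤ) + 4) ≤ |((((x i k - x j k : ℤ) : ZMod (2 * L + 1))).valMinAbs : ℤ)|) →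
      ∀ T : Finset (Fin n),
        torusE G r β L (fun U => ∏ i ∈ T, (1 + (R : ℝ) ^ 4 / C₁ *
          |kerE G r β (fun k => x i k - (R + 1)) (2 * R + 3) U (plane G r (q i) (x i)) -
            torusE G r β L (plane G r (q i) (x i))|)) ≤
          Real.exp (B * T.card))
    (hpin : ∀ β : ℝ, β₁ ≤ β → ∀ (L : ℕ) (q : Fin 4 × Fin 4) (x : Fin 4 → ℤ) (R : ℕ), q.1 < q.2 → 1 ≤ R →
      (R : ℝ) * a β ≤ ℓ₁ → 4 * R + 8 ≤ L → |torusE G r β L (plane G r q x) - p q β| ≤ D / (R : ℝ) ^ 4) :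
    ∀ β : ℝ, β₁ ≤ β → ∀ (L n : ℕ) (q : Fin n → Fin 4 × Fin 4) (x : Fin n → (Fin 4 → ℤ)) (R : ℕ),
      (∀ i, (q i).1 < (q i).2) → 1 ≤ R → (R : ℝ) * a β ≤ ℓ₁ → 4 * R + 8 ≤ L →
      (∀ i j : Fin n, i ≠ j → ∃ k : Fin 4,
        (2 * (R : ℤ) + 4) ≤ |((((x i k - x j k : ℤ) : ZMod (2 * L + 1))).valMinAbs : ℤ)|) →
      ∀ T : Finset (Fin n),
        torusE G r β L (fun U => ∏ i ∈ T, (1 + (R : ℝ) ^ 4 / C₁ *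
          |kerE G r β (fun k => x i k - (R + 1)) (2 * R + 3) U (plane G r (q i) (x i)) - p (q i) β|)) ≤
          Real.exp ((B + D / C₁) * T.card) := by
  intro β hβ L n q x R hq hR hRa hRL hsep T
  have hR0 : (0 : ℝ) < R := by exact_mod_cast (show 0 < R by omega)
  have hclose : ∀ i ∈ T, |torusE G r β L (plane G r (q i) (x i)) - p (q i) β| ≤ D / (R : ℝ) ^ 4 :=
    fun i _ => hpin β hβ L (q i) (x i) R (hq i) hR hRa hRL
  rcases T.eq_empty_or_nonempty with hT | ⟨i₀, hi₀⟩
  · subst hT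
    have h0 := hcen β hβ L n q x R hq hR hRa hRL hsep ∅
    simpa using h0
  have hD : 0 ≤ D / (R : ℝ) ^ 4 := (abs_nonneg _).trans (hclose i₀ hi₀)
  have hδ : (R : ℝ) ^ 4 / C₁ * (D / (R : ℝ) ^ 4) * T.card = D / C₁ * T.card := by
    field_simp
  calc _ ≤ Real.exp ((R : ℝ) ^ 4 / C₁ * (D / (R : ℝ) ^ 4) * T.card) *
          torusE G r β L (fun U => ∏ i ∈ T, (1 + (R : ℝ) ^ 4 / C₁ *
            |kerE G r β (fun k => x i k - (R + 1)) (2 * R + 3) U (plane G r (q i) (x i)) -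
              torusE G r β L (plane G r (q i) (x i))|)) :=
        torusE_prod_response_recentre r β L T q x R hC₁ (fun i => torusE G r β L (plane G r (q i) (x i)))
          (fun i => p (q i) β) hD hclose
    _ ≤ Real.exp (D / C₁ * T.card) * Real.exp (B * T.card) := by
        rw [hδ]
        exact mul_le_mul_of_nonneg_left (hcen β hβ L n q x R hq hR hRa hRL hsep T) (Real.exp_nonneg _)
    _ = Real.exp ((B + D / C₁) * T.card) := by rw [← Real.exp_add]; ring_nf

end Recentring

/-! ## §4 The press-button at the unit of record for `SU(2)` in the fundamental representation -/

section PressButton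

open Summit.QuantumFields.YangMills.Cruxes.OSLegsFromFemtoAndGap.DlrCollarTransfer
open Summit.QuantumFields.YangMills.Cruxes.UVSeamRec.CeilingsTransfer (momentBounds6_of_eventually_le)

variable {G : Type} [Group G] [TopologicalSpace G] [IsTopologicalGroup G] [CompactSpace G]
  [MeasurableSpace G] [BorelSpace G]

/-- **(PM) at an eventually coarser-bounded unit gives the ceilings at the target unit.**  (PM) at unit `a` and
`a β ≤ c·u β` eventually (`c > 0`) ⇒ `MomentBounds6 G r u` (§2 ⊕ the lead's one-sided unit transfer p442252). [folklore] -/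
theorem momentBounds6_of_productMoments_eventually (r : LatticeRep G) {a u : ℝ → ℝ} {c : ℝ} (hc : 0 < c)
    (hle : ∀ᶠ β in atTop, a β ≤ c * u β) {C₁ B β₁ ℓ₁ P₀ : ℝ} {p : Fin 4 × Fin 4 → ℝ → ℝ}
    (hℓ₁ : 0 < ℓ₁) (hC₁ : 0 < C₁) (hp : ∀ q β, |p q β| ≤ P₀)
    (hPM : ∀ β : ℝ, β₁ ≤ β → ∀ (L n : ℕ) (q : Fin n → Fin 4 × Fin 4) (x : Fin n → (Fin 4 → ℤ)) (R : ℕ),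
      (∀ i, (q i).1 < (q i).2) → 1 ≤ R → (R : ℝ) * a β ≤ ℓ₁ → 4 * R + 8 ≤ L →
      (∀ i j : Fin n, i ≠ j → ∃ k : Fin 4,
        (2 * (R : ℤ) + 4) ≤ |((((x i k - x j k : ℤ) : ZMod (2 * L + 1))).valMinAbs : ℤ)|) →
      ∀ T : Finset (Fin n),
        torusE G r β L (fun U => ∏ i ∈ T, (1 + (R : ℝ) ^ 4 / C₁ *
          |kerE G r β (fun k => x i k - (R + 1)) (2 * R + 3) U (plane G r (q i) (x i)) - p (q i) β|)) ≤
          Real.exp (B * T.card)) :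
    MomentBounds6 G r u :=
  momentBounds6_of_eventually_le r hc hle (momentBounds6_of_productMoments r a hℓ₁ hC₁ hp hPM)

/-- **The registered `stub_ceilings` conclusion from the PRODUCT-moment input.**  For `SU(2)` (Borel structure) in the
fundamental lattice representation `rF := fundamentalLatticeRep 2`: if there are a unit `a` and `c > 0` with
`a β ≤ c · uRec β` eventually and (PM) at unit `a` (reference values `p`, constants `C₁ > 0`, `B`, `ℓ₁ > 0`, `β₁`, `P₀`),
then `MomentBounds6 (SU(2)) rF uRec` — the conclusion of the registered `stub_ceilings` VERBATIM.  A v6 skeleton with the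
stub `stub_productMomentsOdd6 : UV → (this hypothesis)` would close `stub_ceilings` by
`exact stubCeilings_of_productMoments (stub_productMomentsOdd6 hUV)`; by §3 it is implied by the v5(α) stub. [folklore] -/
theorem stubCeilings_of_productMoments
    (h : letI : MeasurableSpace (Matrix.specialUnitaryGroup (Fin 2) ℂ) := borel _
      haveI : BorelSpace (Matrix.specialUnitaryGroup (Fin 2) ℂ) := ⟨rfl⟩
      ∃ (a : ℝ → ℝ) (c : ℝ) (C₁ B β₁ ℓ₁ P₀ : ℝ) (p : Fin 4 × Fin 4 → ℝ → ℝ), 0 < c ∧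
        (∀ᶠ β in atTop, a β ≤ c * Transport.uRec β) ∧ 0 < ℓ₁ ∧ 0 < C₁ ∧ (∀ q β, |p q β| ≤ P₀) ∧
        ∀ β : ℝ, β₁ ≤ β → ∀ (L n : ℕ) (q : Fin n → Fin 4 × Fin 4) (x : Fin n → (Fin 4 → ℤ)) (R : ℕ),
          (∀ i, (q i).1 < (q i).2) → 1 ≤ R → (R : ℝ) * a β ≤ ℓ₁ → 4 * R + 8 ≤ L →
          (∀ i j : Fin n, i ≠ j → ∃ k : Fin 4,
            (2 * (R : ℤ) + 4) ≤ |((((x i k - x j k : ℤ) : ZMod (2 * L + 1))).valMinAbs : ℤ)|) →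
          ∀ T : Finset (Fin n),
            torusE (Matrix.specialUnitaryGroup (Fin 2) ℂ) (fundamentalLatticeRep 2) β L
              (fun U => ∏ i ∈ T, (1 + (R : ℝ) ^ 4 / C₁ *
                |kerE (Matrix.specialUnitaryGroup (Fin 2) ℂ) (fundamentalLatticeRep 2) β
                  (fun k => x i k - (R + 1)) (2 * R + 3) U
                  (plane (Matrix.specialUnitaryGroup (Fin 2) ℂ) (fundamentalLatticeRep 2) (q i) (x i)) -
                  p (q i) β|)) ≤ Real.exp (B * T.card)) :
    letI : MeasurableSpace (Matrix.specialUnitaryGroup (Fin 2) ℂ) := borel _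
    haveI : BorelSpace (Matrix.specialUnitaryGroup (Fin 2) ℂ) := ⟨rfl⟩
    MomentBounds6 (Matrix.specialUnitaryGroup (Fin 2) ℂ) (fundamentalLatticeRep 2) Transport.uRec := by
  letI : MeasurableSpace (Matrix.specialUnitaryGroup (Fin 2) ℂ) := borel _
  haveI : BorelSpace (Matrix.specialUnitaryGroup (Fin 2) ℂ) := ⟨rfl⟩
  obtain ⟨a, c, C₁, B, β₁, ℓ₁, P₀, p, hc, hle, hℓ₁, hC₁, hp, hPM⟩ := h
  exact momentBounds6_of_productMoments_eventually (fundamentalLatticeRep 2) hc hle hℓ₁ hC₁ hp hPM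

end PressButton

end Summit.QuantumFields.YangMills.Cruxes.UVSeamRec.ProductMoments

end
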